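import Summits.ResolutionOfSingularities.ResolutionOfSingularities.Theorems.FrobeniusLadderFInjectiveMacaulayficationProp44CurveStepCurves
import HarnessLib

/-!
# [CoP1] Prop. 4.4 (`CossartPiltant2008_prop44`, F-71), the `τ = 1` chain (T1): BLOCK STRUCTURE — consecutive curve steps follow the `Γ′` lineage, so curve
# runs are finite and point steps recur (the chain is a sequence of «fundamental units»)

[L1 W4.5a · crux `FInjectiveMacaulayfication` (stmt-ResolutionOfSingularities-15315); D-0154 (2) RES inputs cell, seat res-inputs-p-8b (gen 2, «assembly»);
piece T1-α of `plan/inputs/T1-ASSEMBLY-MEMO-p8b-v0.md` §1. PROVED, fact-free, definition-free; nothing of the manuscript under adjudication is used. AI-written;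
AI review is weaker than expert review.]

THE CHAIN. Binders of the T1 stub `stub_T1_false_of_nearChain_tau_one` (`candidates/F71_T1_T4_SIGNATURES.lean` v4 l.340): blow-ups `π n : X_{n+1} → X_n` of
regular irreducible centres `Y n ∋ x_n := π n (y n)` inside `{ord J n = μ}`, `y n` near, `π (n+1) (y (n+1)) = y n`, `x_n` closed of embedding dimension `3`,
`V(J n)` of codimension `≥ 2`, and the regime `hcoinc`: locally at `x_n`, `Σ_n = Y_n`. (No `τ` hypothesis and no G-ring hypothesis are needed here.)

* `tauOneChain_curveStep_succ` — **two consecutive CURVE steps follow the `Γ′` lineage**: if neither `Y n` nor `Y (n+1)` is the point, then the generic point of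
  `Y (n+1)` is a near point over the generic point of `Y n`. (The generic point `ζ` of `Y (n+1)` lies in `Σ_{n+1}` and specialises to `x_{n+1}`, so `π n ζ ∈ Σ_n`
  specialises to `x_n` and lies on `Y n` by `hcoinc`; it is not `x_n` — near points over a CLOSED point of a curve centre are closed, p613580 — and a non-closed
  point of `Y n` under `x_n` is its generic point by the codimension count `2 < 3`.)
* `tauOneChain_exists_pointStep_ge` — **curve runs are finite: after every index there is a POINT step** (`Y n = {x_n}`): an infinite run of curve steps would be a
  curve-generic chain, excluded by T3 (`false_of_curveGenericChain`, p611297: the colength at the generic point drops, Zariski–Samuel App. 5).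
So a T1 chain is an infinite sequence of Cossart–Jannsen–Saito FUNDAMENTAL UNITS (Def. 6.38): a point step at an ISOLATED point of `Σ` followed by finitely many
curve steps. `CossartPiltant2008_prop44` is NOT proved; T1 is NOT proved; resolution in dimension `≥ 4` / positive characteristic is NOT proved.

References: V. Cossart, O. Piltant, J. Algebra 320 (2008), Prop. 4.4 (proof, pp. 10–11), Lemma 4.3 (4) [CossartPiltant2008]; V. Cossart, U. Jannsen, S. Saito,
LNM 2270 (2020), Def. 6.38 [CossartJannsenSaito2020]; O. Zariski, P. Samuel, *Commutative Algebra* II, App. 5 Thm. 3 [ZariskiSamuel1960].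
-/

-- `Summit.<Summit>.<Sub>.Theorems` with `Sub = Summit` (single-conjunct summit, D-0017)
set_option linter.dupNamespace false

noncomputable section

open CategoryTheory CategoryTheory.Limits AlgebraicGeometry TopologicalSpace IsLocalRing
open Literature.AlgebraicGeometry.Resolution Scheme.IdealSheafData

namespace Summit.ResolutionOfSingularities.ResolutionOfSingularities.Theorems

namespace CP2008Prop44

universe u

/-! ## §0 Points of a regular curve through a closed threefold point -/

/-- **On a regular irreducible closed `Y` through a CLOSED point `x` of embedding dimension `3`, with `Y ≠ {x}` and `V(J)` of codimension `≥ 2` containing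
`Y`: the generic point `η` of `Y` has codimension `2`, and a point of `Y` specialising to `x` is `x` or `η`.** [cite: StacksProject, Tag 02IZ] -/
theorem genericPoint_curve_facts {X : Scheme.{u}} [IsLocallyNoetherian X] (hX : Scheme.IsRegular X) {J : X.IdealSheafData} {μ : ℕ} (hμ : 1 ≤ μ)
    (hcodim : ∀ z ∈ J.support, 1 < Order.coheight z) {Y : Closeds X} (hYirr : IsIrreducible (Y : Set X))
    (hYord : ∀ z ∈ (Y : Set X), idealOrder J z = μ) {x : X} (hx : x ∈ (Y : Set X)) (hcl : IsClosed ({x} : Set X))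
    (hd : (maximalIdeal (X.presheaf.stalk x)).spanFinrank = 3) (hYx : (Y : Set X) ≠ {x}) :
    (Y : Set X) = closure {hYirr.genericPoint} ∧ hYirr.genericPoint ≠ x ∧ hYirr.genericPoint ⤳ x ∧
      Order.coheight hYirr.genericPoint = 2 ∧ Order.coheight x = 3 ∧
      ∀ z ∈ (Y : Set X), z ⤳ x → z = x ∨ z = hYirr.genericPoint := by
  set η := hYirr.genericPoint with hηdef
  have hYη : (Y : Set X) = closure {η} := (hYirr.closure_genericPoint Y.isClosed).symm
  haveI := hX x
  have hcohx : Order.coheight x = 3 := by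
    rw [CampaignW46.coheight_eq_spanFinrank x, hd]; rfl
  have hηx : η ⤳ x := specializes_iff_mem_closure.mpr (hYη ▸ hx)
  have hne : η ≠ x := by
    intro h
    apply hYx
    rw [hYη, h, hcl.closure_eq]
  have hxη : ¬ x ⤳ η := fun h => hne (Specializes.antisymm hηx h).eq
  have hηsupp : η ∈ J.support := by
    rw [← one_le_idealOrder_iff, hYord η (by rw [hYη]; exact subset_closure rfl)]; exact_mod_cast hμ
  obtain ⟨hcohη, -⟩ := coheight_eq_two_of_specializes hηx hxη (hcodim η hηsupp) hcohx.le
  refine ⟨hYη, hne, hηx, hcohη, hcohx, fun z hz hzx => ?_⟩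
  by_cases hzx' : z = x
  · exact Or.inl hzx'
  · right
    have hxz : ¬ x ⤳ z := fun h => hzx' ((Specializes.antisymm hzx h).eq)
    have hηz : η ⤳ z := specializes_iff_mem_closure.mpr (hYη ▸ hz)
    -- `coheight z = 2`: between `η` (2) and `x` (3)
    have hzsupp : z ∈ J.support := by
      rw [← one_le_idealOrder_iff, hYord z hz]; exact_mod_cast hμ
    obtain ⟨hcohz, -⟩ := coheight_eq_two_of_specializes hzx hxz (hcodim z hzsupp) hcohx.le
    by_contra hzη
    have hzη' : ¬ z ⤳ η := fun h => hzη ((Specializes.antisymm h hηz).eq)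
    have hlt : z < η := lt_of_le_not_ge (Scheme.le_iff_specializes.mpr hηz) fun h' => hzη' (Scheme.le_iff_specializes.mp h')
    have h1 : Order.coheight η + 1 ≤ Order.coheight z := Order.coheight_add_one_le hlt
    rw [hcohη, hcohz] at h1
    exact absurd h1 (by decide)

/-! ## §1 Two consecutive curve steps follow the `Γ′` lineage -/

/-- **Consecutive curve steps of a T1 chain follow the `Γ′` lineage.** Chain data = the binders of `stub_T1_false_of_nearChain_tau_one` minus `τ`/G-ring/`ord ≤ μ`; if
neither `Y n` nor `Y (n+1)` is the point `{x_n}` resp. `{x_{n+1}}`, then the generic point of `Y (n+1)` maps to the generic point of `Y n`, is near, and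
`Y (n+1)` is the closure of that near point. [cite: CossartPiltant2008, Prop. 4.4 (proof, p. 10), Lemma 4.3 (4)] -/
theorem tauOneChain_curveStep_succ (Xs : ℕ → Scheme.{u})
    (hN : ∀ n, IsLocallyNoetherian (Xs n)) (hXreg : ∀ n, Scheme.IsRegular (Xs n))
    (π : ∀ n, Xs (n + 1) ⟶ Xs n) (Y : ∀ n, Closeds (Xs n)) (y : ∀ n, Xs (n + 1))
    (J : ∀ n, (Xs n).IdealSheafData) {μ : ℕ} (hμ : 1 ≤ μ)
    (hy : ∀ n, π (n + 1) (y (n + 1)) = y n)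
    (hmem : ∀ n, π n (y n) ∈ (Y n : Set (Xs n)))
    (hcl : ∀ n, IsClosed ({π n (y n)} : Set (Xs n)))
    (hYirr : ∀ n, IsIrreducible ((Y n : Closeds (Xs n)) : Set (Xs n)))
    (hYreg : ∀ n, Scheme.IsRegular (vanishingIdeal (Y n)).subscheme)
    (hYord : ∀ n, ∀ z ∈ (Y n : Set (Xs n)), idealOrder (J n) z = μ)
    (hπ : ∀ n, IsBlowup (π n) (vanishingIdeal (Y n)))
    (hJ : ∀ n, J (n + 1) = controlledTransform (π n) (vanishingIdeal (Y n)) (J n) μ)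
    (hcodim : ∀ n, ∀ z ∈ (J n).support, 1 < Order.coheight z)
    (hd : ∀ n, (maximalIdeal ((Xs n).presheaf.stalk (π n (y n)))).spanFinrank = 3)
    (hcoinc : ∀ n (z : Xs n), z ⤳ π n (y n) → idealOrder (J n) z = μ → z ∈ (Y n : Set (Xs n)))
    (n : ℕ) (hn : (Y n : Set (Xs n)) ≠ {π n (y n)}) (hn1 : (Y (n + 1) : Set (Xs (n + 1))) ≠ {π (n + 1) (y (n + 1))}) :
    π n (hYirr (n + 1)).genericPoint = (hYirr n).genericPoint ∧
      IsNear (π n) (vanishingIdeal (Y n)) (J n) μ (hYirr (n + 1)).genericPoint ∧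
      (Y (n + 1) : Set (Xs (n + 1))) = closure {(hYirr (n + 1)).genericPoint} ∧
      Order.coheight (hYirr n).genericPoint = 2 ∧ Order.coheight (hYirr (n + 1)).genericPoint = 2 := by
  haveI := hN
  -- the curve `Y n` through `x_n`, and `Y (n+1)` through `x_{n+1} = y n`
  obtain ⟨hYη, hηne, hηx, hcohη, hcohx, hgen⟩ :=
    genericPoint_curve_facts (hXreg n) hμ (hcodim n) (hYirr n) (hYord n) (hmem n) (hcl n) (hd n) hn
  obtain ⟨hYζ, hζne, hζx, hcohζ, -, -⟩ :=
    genericPoint_curve_facts (hXreg (n + 1)) hμ (hcodim (n + 1)) (hYirr (n + 1)) (hYord (n + 1)) (hmem (n + 1)) (hcl (n + 1))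
      (hd (n + 1)) hn1
  set η := (hYirr n).genericPoint
  set ζ := (hYirr (n + 1)).genericPoint
  have hx1 : π (n + 1) (y (n + 1)) = y n := hy n
  -- `π n ζ` specialises to `x_n` and lies in `Σ_n`, hence on `Y n`
  have hζy : ζ ⤳ y n := hx1 ▸ hζx
  have hπζx : π n ζ ⤳ π n (y n) := hζy.map (π n).continuous
  have hζord : idealOrder (J (n + 1)) ζ = μ := hYord (n + 1) ζ (by rw [hYζ]; exact subset_closure rfl)
  have hπζY : π n ζ ∈ (Y n : Set (Xs n)) := by
    by_contra hnot
    have hnot' : π n ζ ∉ ((vanishingIdeal (Y n)).support : Set (Xs n)) := by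
      rwa [Scheme.IdealSheafData.coe_support_vanishingIdeal]
    have hord : idealOrder (J n) (π n ζ) = μ := by
      rw [← (hπ n).idealOrder_controlledTransform_of_not_mem (J n) μ hnot', ← hJ n]; exact hζord
    exact hnot (hcoinc n (π n ζ) hπζx hord)
  have hnear : IsNear (π n) (vanishingIdeal (Y n)) (J n) μ ζ := by
    rw [isNear_iff, ← hJ n]; exact hζord
  -- `π n ζ ≠ x_n`: a near point over the closed point `x_n` of the curve centre is closed, `ζ` is not
  have hπζne : π n ζ ≠ π n (y n) := by
    intro heq
    haveI : IsRegularLocalRing ((Xs n).presheaf.stalk (π n ζ)) := hXreg n _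
    have hcohπζ : Order.coheight (π n ζ) ≤ 3 := by rw [heq, hcohx]
    obtain ⟨c, hcr, hcY⟩ := exists_isRsopPart_fin_two_of_specializes (hYreg n) hYη (by rw [heq]; exact hηx)
      (by rw [heq]; exact fun h => hηne (Specializes.antisymm hηx h).eq) (by rw [hcohη]; exact_mod_cast one_lt_two) hcohπζ
    have hclζ : IsClosed ({ζ} : Set (Xs (n + 1))) :=
      (hπ n).isClosed_singleton_of_isNear_curve (hXreg n) (hXreg (n + 1)) (hYreg n) hμ (hYord n) (by rw [heq]; exact hcl n) hcr hcY hnear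
    apply hn1
    rw [hYζ, hclζ.closure_eq, hx1]
    -- `ζ` closed and `ζ ⤳ y n` force `ζ = y n`
    have : y n ∈ closure ({ζ} : Set (Xs (n + 1))) := specializes_iff_mem_closure.mp hζy
    rw [hclζ.closure_eq, Set.mem_singleton_iff] at this
    rw [this]
  -- hence `π n ζ = η`
  have hπζη : π n ζ = η := by
    rcases hgen (π n ζ) hπζY hπζx with h | h
    · exact absurd h hπζne
    · exact h
  exact ⟨hπζη, hnear, hYζ, hcohη, hcohζ⟩

/-! ## §2 Curve runs are finite: point steps recur -/

/-- **After every index of a T1 chain there is a POINT step** (`Y n = {x_n}`): otherwise the generic points of the curve centres from some index on form an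
infinite curve-generic chain, excluded by T3 (`false_of_curveGenericChain`: the colength at the generic point is finite and drops at each step).
[cite: CossartPiltant2008, Prop. 4.4 (proof, p. 10)] [cite: ZariskiSamuel1960, Appendix 5, Thm. 3] -/
theorem tauOneChain_exists_pointStep_ge (Xs : ℕ → Scheme.{u})
    (hN : ∀ n, IsLocallyNoetherian (Xs n)) (hXreg : ∀ n, Scheme.IsRegular (Xs n))
    (π : ∀ n, Xs (n + 1) ⟶ Xs n) (Y : ∀ n, Closeds (Xs n)) (y : ∀ n, Xs (n + 1))
    (J : ∀ n, (Xs n).IdealSheafData) {μ : ℕ} (hμ : 1 ≤ μ)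
    (hy : ∀ n, π (n + 1) (y (n + 1)) = y n)
    (hmem : ∀ n, π n (y n) ∈ (Y n : Set (Xs n)))
    (hcl : ∀ n, IsClosed ({π n (y n)} : Set (Xs n)))
    (hYirr : ∀ n, IsIrreducible ((Y n : Closeds (Xs n)) : Set (Xs n)))
    (hYreg : ∀ n, Scheme.IsRegular (vanishingIdeal (Y n)).subscheme)
    (hYord : ∀ n, ∀ z ∈ (Y n : Set (Xs n)), idealOrder (J n) z = μ)
    (hπ : ∀ n, IsBlowup (π n) (vanishingIdeal (Y n)))
    (hJ : ∀ n, J (n + 1) = controlledTransform (π n) (vanishingIdeal (Y n)) (J n) μ)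
    (hcodim : ∀ n, ∀ z ∈ (J n).support, 1 < Order.coheight z)
    (hd : ∀ n, (maximalIdeal ((Xs n).presheaf.stalk (π n (y n)))).spanFinrank = 3)
    (hcoinc : ∀ n (z : Xs n), z ⤳ π n (y n) → idealOrder (J n) z = μ → z ∈ (Y n : Set (Xs n)))
    (n₀ : ℕ) : ∃ n, n₀ ≤ n ∧ (Y n : Set (Xs n)) = {π n (y n)} := by
  haveI := hN
  by_contra hno
  push Not at hno
  -- every step from `n₀` on is a curve step
  have hcurve : ∀ k, (Y (n₀ + k) : Set (Xs (n₀ + k))) ≠ {π (n₀ + k) (y (n₀ + k))} := fun k => hno (n₀ + k) (Nat.le_add_right n₀ k)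
  -- the re-indexed curve-generic chain
  let η : ∀ k, Xs (n₀ + k) := fun k => (hYirr (n₀ + k)).genericPoint
  have hstep : ∀ k, π (n₀ + k) (η (k + 1)) = η k ∧ IsNear (π (n₀ + k)) (vanishingIdeal (Y (n₀ + k))) (J (n₀ + k)) μ (η (k + 1)) ∧
      (Y (n₀ + k + 1) : Set (Xs (n₀ + k + 1))) = closure {η (k + 1)} ∧
      Order.coheight (η k) = 2 ∧ Order.coheight (η (k + 1)) = 2 := fun k =>
    tauOneChain_curveStep_succ Xs hN hXreg π Y y J hμ hy hmem hcl hYirr hYreg hYord hπ hJ hcodim hd hcoinc (n₀ + k) (hcurve k) (hcurve (k + 1))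
  have hYη : ∀ k, ((Y (n₀ + k) : Closeds (Xs (n₀ + k))) : Set (Xs (n₀ + k))) = closure {η k} := fun k =>
    ((hYirr (n₀ + k)).closure_genericPoint (Y (n₀ + k)).isClosed).symm
  refine false_of_curveGenericChain (fun k => Xs (n₀ + k)) (fun k => hN (n₀ + k)) (fun k => π (n₀ + k)) (fun k => Y (n₀ + k)) η
    (fun k => J (n₀ + k)) hμ (fun k => hπ (n₀ + k)) (fun k => hJ (n₀ + k)) hYη (fun k => hYord (n₀ + k)) (fun k => (hstep k).1)
    (fun k => hXreg (n₀ + k) _) (fun k => ?_) (fun k => (hstep k).2.2.2.1)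
  -- maximal points: codimension `2` + `V(J)` of codimension `≥ 2`
  have hηY : η k ∈ (Y (n₀ + k) : Set (Xs (n₀ + k))) := by rw [hYη k]; exact subset_closure rfl
  exact mem_maxPoints_support_of_coheight_eq_two (hcodim (n₀ + k))
    (by rw [SetLike.mem_coe, ← one_le_idealOrder_iff, hYord (n₀ + k) _ hηY]; exact_mod_cast hμ) (hstep k).2.2.2.1

end CP2008Prop44

end Summit.ResolutionOfSingularities.ResolutionOfSingularities.Theorems

end
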